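import Literature.NumberTheory.GaloisRepresentations.AbstractReciprocityLawCyclic
import Mathlib.GroupTheory.FiniteAbelian.Basic
import HarnessLib

/-!
# Abstract class field theory in Weil-group form, part 4: the general reciprocity law for abelian pairs (Neukirch, *Algebraic Number Theory*, Ch. IV §6, Thm. (6.3))

Continuation of `AbstractReciprocityLawCyclic.lean`.  For an **abelian pair** `V ≤ U` of fields of a
datum `d : WeilDatum W A` (`U = G_K ∩ W ⊇ V = G_L ∩ W` with `⁅U, U⁆ ≤ V`: "`L|K` abelian") satisfying
the class field axiom (`d.IsClassFieldTheory`), Neukirch's reciprocity map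
`r_{L|K} : G(L|K) → A_K / N_{L|K} A_L` (`d.recMap U V`, (5.6)) is an isomorphism:

* `IsClassFieldTheory.mem_of_recMap_eq_one` (injectivity; Neukirch's *second reduction*: the
  cyclic quotients `G(M|K)` of the finite abelian group `G(L|K)` separate points — realised through
  the structure theorem `CommGroup.equiv_prod_multiplicative_zmod_of_finite` — and the cyclic case);
* `IsClassFieldTheory.exists_recMap_eq` (surjectivity, by induction on `[L : K]` along a cyclic
  quotient `M|K`, with (5.8) and the cyclic case);
* the range and kernel of `r_{L|K}` (`range_recHom`, `ker_recHom`: `U/V ≅ A^U/N_{V|U}A^V`) and the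
  **norm residue symbol** as a representative `IsClassFieldTheory.normResidue : A^U → W` (`(a, L|K)`,
  the inverse of `r_{L|K}`, well defined modulo `V`): multiplicative modulo `V`, in `V` iff
  `a ∈ N_{L|K} A_L`, every class of `U/V` is hit (`normResidue_*`); stated without quotient groups so
  that no normality instance on `V ≤ U` is needed;
* the consequences used by the local theory: norm functoriality in the form
  `r_{L|K}(τ) = N_{K'|K}(c)` whenever `r_{L'|K'}(τ) = c` (`recMap_eq_mk_norm_of_recMap_eq`, from
  (5.8)), and the **inertia clause**: the norm residue symbol maps the units `U_K` onto the image of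
  the inertia group `G(L̃|K̃) = U ∩ I` in `G(L|K)` (`exists_unit_recMap_eq_of_mem_inertia`,
  `exists_inertia_recMap_eq_of_unit`; Serre, *Local Fields* XIII §4 Cor. to Prop. 13 in the local
  case), via the maximal unramified subextension `M = L ∩ K̃` (group `V ⊔ (U ⊓ I)`), (6.2) and (5.8).

## References

* J. Neukirch, *Algebraic Number Theory*, Grundlehren 322, Springer 1999, Ch. IV §6, Thm. (6.3)
  (proof: first and second reductions), (6.4); §5 (5.7), (5.8).  [NeukirchANT1999]
* J.-P. Serre, *Local Fields*, GTM 67, Springer 1979, Ch. XIII §4, Cor. to Prop. 13.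
  [SerreLocalFields1979]
-/

noncomputable section

open scoped Pointwise

namespace Literature.NumberTheory.GaloisRepresentations

namespace AbstractCFT

variable {W : Type*} [Group W] {A : Type*} [CommGroup A] [MulDistribMulAction W A]

namespace WeilDatum

variable (d : WeilDatum W A)

/-! ### Abelian pairs -/

/-- An **abelian pair** `(U, V)`: fields `V ≤ U` with `⁅U, U⁆ ≤ V` ("`L|K` finite abelian": the
Galois group `G(L|K) = U/V` is abelian; then `V` is normal in `U`).
[cite: NeukirchANT1999, Ch. IV §6, Thm. (6.3) (first reduction)] -/
structure IsAbelianPair (U V : Subgroup W) : Prop where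
  isField_left : d.IsField U
  isField_right : d.IsField V
  le : V ≤ U
  commutator_mem : ∀ a ∈ U, ∀ b ∈ U, a * b * a⁻¹ * b⁻¹ ∈ V

variable {d}

/-- In an abelian pair `V` is normal in `U`. [folklore] -/
theorem IsAbelianPair.le_normalizer {U V : Subgroup W} (h : d.IsAbelianPair U V) :
    U ≤ Subgroup.normalizer (V : Set W) := by
  intro u hu
  rw [Subgroup.mem_normalizer_iff]
  intro x
  constructor
  · intro hx
    have h1 := h.commutator_mem u hu x (h.le hx)
    simpa using V.mul_mem h1 hx
  · intro hx
    have h1 := h.commutator_mem u⁻¹ (U.inv_mem hu) (u * x * u⁻¹)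
      (U.mul_mem (U.mul_mem hu ?_) (U.inv_mem hu))
    · have h2 := V.mul_mem h1 hx
      have e : u⁻¹ * (u * x * u⁻¹) * u⁻¹⁻¹ * (u * x * u⁻¹)⁻¹ * (u * x * u⁻¹) = x := by group
      rw [e] at h2
      exact h2
    · -- `x ∈ U`: `x = u⁻¹ (u x u⁻¹) u`
      have e : x = u⁻¹ * (u * x * u⁻¹) * u := by group
      rw [e]
      exact U.mul_mem (U.mul_mem (U.inv_mem hu) (h.le hx)) hu

/-- Cyclic pairs are abelian. [folklore] -/
theorem IsCyclicPair.isAbelianPair {U V : Subgroup W} {σ : W} (hcp : d.IsCyclicPair U V σ) :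
    d.IsAbelianPair U V where
  isField_left := hcp.isField_left
  isField_right := hcp.isField_right
  le := hcp.le
  commutator_mem := fun _ ha _ hb => hcp.commutator_mem ha hb

/-- Intermediate fields of an abelian pair give abelian pairs (upper part). [folklore] -/
theorem IsAbelianPair.of_le {U V : Subgroup W} (h : d.IsAbelianPair U V) {M : Subgroup W}
    (hM : d.IsField M) (hVM : V ≤ M) (hMU : M ≤ U) : d.IsAbelianPair U M where
  isField_left := h.isField_left
  isField_right := hM
  le := hMU
  commutator_mem := fun a ha b hb => hVM (h.commutator_mem a ha b hb)

/-- Intermediate fields of an abelian pair give abelian pairs (lower part). [folklore] -/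
theorem IsAbelianPair.restrict {U V : Subgroup W} (h : d.IsAbelianPair U V) {M : Subgroup W}
    (hM : d.IsField M) (hVM : V ≤ M) (hMU : M ≤ U) : d.IsAbelianPair M V where
  isField_left := hM
  isField_right := h.isField_right
  le := hVM
  commutator_mem := fun a ha b hb => h.commutator_mem a (hMU ha) b (hMU hb)

/-- The trivial pair `(U, U)` is abelian. [folklore] -/
theorem isAbelianPair_self {U : Subgroup W} (hU : d.IsField U) : d.IsAbelianPair U U where
  isField_left := hU
  isField_right := hU
  le := le_rfl
  commutator_mem := fun _ ha _ hb =>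
    U.mul_mem (U.mul_mem (U.mul_mem ha hb) (U.inv_mem ha)) (U.inv_mem hb)

/-- **Cyclic quotients separate points** (the group-theoretic content of Neukirch's second
reduction: "the map `G(L|K) → ∏_M G(M|K)`, `M|K` cyclic, is injective"): for `τ ∈ U ∖ V` in an
abelian pair there is an intermediate field `M ⊇ V` not containing `τ` with `(U, M)` a cyclic pair.
Proof via the structure theorem for finite abelian groups: some cyclic factor of `U/V` sees `τ`.
[cite: NeukirchANT1999, Ch. IV §6, Thm. (6.3) (proof, second reduction)] -/
theorem IsAbelianPair.exists_isCyclicPair_not_mem {U V : Subgroup W} (h : d.IsAbelianPair U V)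
    {τ : W} (hτU : τ ∈ U) (hτV : τ ∉ V) :
    ∃ (M : Subgroup W) (σ : W), V ≤ M ∧ τ ∉ M ∧ d.IsCyclicPair U M σ := by
  classical
  haveI : (V.subgroupOf U).Normal :=
    (Subgroup.normal_subgroupOf_iff_le_normalizer h.le).mpr h.le_normalizer
  haveI := d.finiteIndex h.isField_right
  -- the finite abelian group `Q = U/V`
  have hcomm : ∀ a b : U ⧸ V.subgroupOf U, a * b = b * a := by
    intro a b
    induction a using QuotientGroup.induction_on with | H x => ?_
    induction b using QuotientGroup.induction_on with | H y => ?_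
    rw [← QuotientGroup.mk_mul, ← QuotientGroup.mk_mul, QuotientGroup.eq, Subgroup.mem_subgroupOf]
    have := h.commutator_mem _ (U.inv_mem y.2) _ (U.inv_mem x.2)
    have e : ((x * y)⁻¹ * (y * x) : U) = y⁻¹ * x⁻¹ * y⁻¹⁻¹ * x⁻¹⁻¹ := by group
    rw [e]
    simpa using this
  letI : CommGroup (U ⧸ V.subgroupOf U) :=
    { (inferInstance : Group (U ⧸ V.subgroupOf U)) with mul_comm := hcomm }
  obtain ⟨ι, _, n, hn, ⟨e⟩⟩ := CommGroup.equiv_prod_multiplicative_zmod_of_finite (U ⧸ V.subgroupOf U)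
  -- a cyclic factor seeing `τ`
  set t : U ⧸ V.subgroupOf U := ((⟨τ, hτU⟩ : U) : U ⧸ V.subgroupOf U) with ht
  have ht1 : t ≠ 1 := by
    intro h1
    rw [ht, QuotientGroup.eq_one_iff, Subgroup.mem_subgroupOf] at h1
    exact hτV h1
  have hi : ∃ i : ι, e t i ≠ 1 := by
    by_contra hall
    apply ht1
    apply e.injective
    rw [map_one]
    funext i
    exact not_not.mp (not_exists.mp hall i)
  obtain ⟨i, hi⟩ := hi
  set χ : U ⧸ V.subgroupOf U →* Multiplicative (ZMod (n i)) :=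
    (Pi.evalMonoidHom (fun j => Multiplicative (ZMod (n j))) i).comp e.toMonoidHom with hχ
  have hχ_apply : ∀ q, χ q = e q i := fun q => rfl
  set ψ : U →* Multiplicative (ZMod (n i)) := χ.comp (QuotientGroup.mk' (V.subgroupOf U)) with hψ
  have hψ_apply : ∀ x : U, ψ x = χ (x : U ⧸ V.subgroupOf U) := fun x => rfl
  set M : Subgroup W := ψ.ker.map U.subtype with hM
  have hMmem : ∀ {w : W}, w ∈ M ↔ ∃ hw : w ∈ U, ψ ⟨w, hw⟩ = 1 := by
    intro w
    rw [hM]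
    constructor
    · rintro ⟨x, hx, rfl⟩
      exact ⟨x.2, hx⟩
    · rintro ⟨hw, hx⟩
      exact ⟨⟨w, hw⟩, hx, rfl⟩
  have hMU : M ≤ U := fun w hw => (hMmem.mp hw).1
  have hVM : V ≤ M := by
    intro v hv
    refine hMmem.mpr ⟨h.le hv, ?_⟩
    rw [hψ_apply]
    have : (((⟨v, h.le hv⟩ : U)) : U ⧸ V.subgroupOf U) = 1 := by
      rw [QuotientGroup.eq_one_iff, Subgroup.mem_subgroupOf]
      exact hv
    rw [this, map_one]
  have hτM : τ ∉ M := by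
    intro hτM
    obtain ⟨_, h1⟩ := hMmem.mp hτM
    rw [hψ_apply, hχ_apply] at h1
    exact hi h1
  -- a generator: the range of `ψ` is cyclic
  obtain ⟨g, hg⟩ := IsCyclic.exists_generator (α := ψ.range)
  obtain ⟨σ₀, hσ₀⟩ := g.2
  refine ⟨M, (σ₀ : W), hVM, hτM,
    { isField_left := h.isField_left
      isField_right := d.isField_of_le h.isField_right hVM
      le := hMU
      le_normalizer := ?_
      mem := σ₀.2
      gen := ?_ }⟩
  · intro u hu
    rw [Subgroup.mem_normalizer_iff]
    intro m
    constructor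
    · intro hm
      obtain ⟨hmU, hm1⟩ := hMmem.mp hm
      refine hMmem.mpr ⟨U.mul_mem (U.mul_mem hu hmU) (U.inv_mem hu), ?_⟩
      have : (⟨u * m * u⁻¹, U.mul_mem (U.mul_mem hu hmU) (U.inv_mem hu)⟩ : U) =
          ⟨u, hu⟩ * ⟨m, hmU⟩ * (⟨u, hu⟩)⁻¹ := rfl
      rw [this, map_mul, map_mul, map_inv, hm1, mul_one, mul_inv_cancel]
    · intro hm
      obtain ⟨hmU, hm1⟩ := hMmem.mp hm
      have hmU' : m ∈ U := by
        have e1 : m = u⁻¹ * (u * m * u⁻¹) * u := by group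
        rw [e1]
        exact U.mul_mem (U.mul_mem (U.inv_mem hu) hmU) hu
      refine hMmem.mpr ⟨hmU', ?_⟩
      have : (⟨u * m * u⁻¹, hmU⟩ : U) = ⟨u, hu⟩ * ⟨m, hmU'⟩ * (⟨u, hu⟩)⁻¹ := rfl
      rw [this, map_mul, map_mul, map_inv, mul_inv_eq_one, mul_eq_left] at hm1
      exact hm1
  · intro w hw
    obtain ⟨k, hk⟩ := Subgroup.mem_zpowers_iff.mp (hg ⟨ψ ⟨w, hw⟩, ⟨⟨w, hw⟩, rfl⟩⟩)
    have hk' := congrArg Subtype.val hk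
    simp only [SubgroupClass.coe_zpow] at hk'
    rw [← hσ₀] at hk'
    -- hk' : ψ σ₀ ^ k = ψ ⟨w, hw⟩
    refine ⟨k, hMmem.mpr ⟨U.mul_mem (U.inv_mem (U.zpow_mem σ₀.2 k)) hw, ?_⟩⟩
    have : (⟨((σ₀ : W) ^ k)⁻¹ * w, U.mul_mem (U.inv_mem (U.zpow_mem σ₀.2 k)) hw⟩ : U) =
        (σ₀ ^ k)⁻¹ * ⟨w, hw⟩ := by
      apply Subtype.ext
      simp
    rw [this, map_mul, map_inv, map_zpow, hk', inv_mul_cancel]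

/-! ### The reciprocity law for abelian pairs (Neukirch (6.3)) -/

/-- **(6.3) — injectivity**: for an abelian pair and the class field axiom, `r_{L|K}(τ) = 1 ⟹ τ ∈ G_L`
(`τ ∈ G_K`).  Second reduction: if `τ ∉ G_L`, some cyclic quotient `M|K` of `L|K` has `τ ∉ G_M`,
but `r_{M|K}(τ) = 1` by compatibility (5.8), contradicting the cyclic case.
[cite: NeukirchANT1999, Ch. IV §6, Thm. (6.3)] -/
theorem IsClassFieldTheory.mem_of_recMap_eq_one (hcf : d.IsClassFieldTheory) {U V : Subgroup W}
    (hab : d.IsAbelianPair U V) {τ : W} (hτ : τ ∈ U) (h1 : d.recMap U V τ = 1) : τ ∈ V := by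
  by_contra hτV
  obtain ⟨M, σ, hVM, hτM, hcp⟩ := hab.exists_isCyclicPair_not_mem hτ hτV
  have hU := hab.isField_left
  have hV := hab.isField_right
  have h2 : d.recMap U M τ = 1 := by
    rw [hcf.recMap_eq_map_recMap hU hcp.isField_right hcp.le hcp.le_normalizer hV hab.le
      hab.le_normalizer hVM hτ, h1, map_one]
  exact hτM (hcf.mem_of_recMap_eq_one_of_isCyclicPair hcp hτ h2)

/-- **(6.3) — the kernel**: `r_{L|K}(τ) = 1 ↔ τ ∈ G_L` for `τ ∈ G_K`, `L|K` abelian.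
[cite: NeukirchANT1999, Ch. IV §6, Thm. (6.3)] -/
theorem IsClassFieldTheory.recMap_eq_one_iff (hcf : d.IsClassFieldTheory) {U V : Subgroup W}
    (hab : d.IsAbelianPair U V) {τ : W} (hτ : τ ∈ U) : d.recMap U V τ = 1 ↔ τ ∈ V :=
  ⟨hcf.mem_of_recMap_eq_one hab hτ,
    fun h => d.recMap_eq_one_of_mem hab.isField_left hab.isField_right hab.le hab.le_normalizer h⟩

/-- **(6.3) — equal values**: `r_{L|K}(τ) = r_{L|K}(τ') ↔ τ⁻¹τ' ∈ G_L`.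
[cite: NeukirchANT1999, Ch. IV §6, Thm. (6.3)] -/
theorem IsClassFieldTheory.recMap_eq_recMap_iff (hcf : d.IsClassFieldTheory) {U V : Subgroup W}
    (hab : d.IsAbelianPair U V) {τ τ' : W} (hτ : τ ∈ U) (hτ' : τ' ∈ U) :
    d.recMap U V τ = d.recMap U V τ' ↔ τ⁻¹ * τ' ∈ V := by
  have hU := hab.isField_left
  have hV := hab.isField_right
  rw [← hcf.recMap_eq_one_iff hab (U.mul_mem (U.inv_mem hτ) hτ'),
    hcf.recMap_mul hU hV hab.le hab.le_normalizer (U.inv_mem hτ) hτ',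
    hcf.recMap_inv hU hV hab.le hab.le_normalizer hτ, inv_mul_eq_one, eq_comm]

/-- **Norm functoriality, value form** ((5.8), left diagram): for `K ⊆ K'`, `L ⊆ L'` (`U' ≤ U`,
`V' ≤ V`) and `τ ∈ G(L'|K')`: if `r_{L'|K'}(τ) = c mod N_{L'|K'}A_{L'}` with `c ∈ A_{K'}`, then
`r_{L|K}(τ) = N_{K'|K}(c) mod N_{L|K}A_L`. [cite: NeukirchANT1999, Ch. IV §5, Prop. (5.8)] -/
theorem IsClassFieldTheory.recMap_eq_mk_norm_of_recMap_eq (hcf : d.IsClassFieldTheory)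
    {U V U' V' : Subgroup W} (hU : d.IsField U) (hV : d.IsField V) (hVU : V ≤ U)
    (hUn : U ≤ Subgroup.normalizer (V : Set W)) (hU' : d.IsField U') (hV' : d.IsField V')
    (hV'U' : V' ≤ U') (hU'n : U' ≤ Subgroup.normalizer (V' : Set W)) (hU'U : U' ≤ U) (hV'V : V' ≤ V)
    {τ : W} (hτ : τ ∈ U') {c : A} (h : d.recMap U' V' τ = QuotientGroup.mk c) :
    d.recMap U V τ = QuotientGroup.mk (norm U' U c) := by
  haveI := d.finiteIndex hU'
  haveI := d.finiteIndex hV'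
  haveI := d.finiteIndex hV
  set σ' := d.frobLift U' V' τ with hσ'
  have hσ'U' := d.frobLift_mem (V := V') hU' hτ
  have hd := d.degZ_frobLift_pos (V := V') hU' hV' τ
  have hlift := d.inv_mul_frobLift_mem hU' hV' hV'U' hU'n τ
  rw [hcf.recMap_eq_mk_norm_recElt hU hV hVU hUn hU' hV' hV'U' hU'n hU'U hV'V hτ hσ'U' hd hlift,
    QuotientGroup.eq]
  -- `recElt U' V' σ' = c · n` with `n ∈ N_{L'|K'} A_{L'}`
  have h2 : d.recMap U' V' τ = QuotientGroup.mk (d.recElt U' V' σ') := rfl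
  rw [h, QuotientGroup.eq] at h2
  obtain ⟨b, hb, hbn⟩ := mem_normGroup_iff.mp h2
  have hrec : d.recElt U' V' σ' = c * norm V' U' b := by
    rw [hbn, mul_inv_cancel_left]
  rw [hrec, norm_mul, norm_norm hV'U' hU'U hb]
  have : (norm U' U c * norm V' U b)⁻¹ * norm U' U c = (norm V' U b)⁻¹ := by
    rw [mul_inv_rev, inv_mul_cancel_right]
  rw [this]
  exact (normGroup V U).inv_mem (normGroup_le_normGroup hV'V hVU (norm_mem_normGroup hb))

/-- Combining the steps of a tower `K ⊆ M ⊆ L`: if `r_{L|M}(ρ) = m` and `r_{L|K}(τ) = c` with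
`c⁻¹ a = N_{M|K}(m)`, then `r_{L|K}(τρ) = a` (the diagram chase behind "if `r_{M|K}` and `r_{L|M}`
are surjective, then so is `r_{L|K}`"). [cite: NeukirchANT1999, Ch. IV §6, Thm. (6.3) (proof)] -/
theorem IsClassFieldTheory.recMap_mul_eq_of_tower (hcf : d.IsClassFieldTheory) {U V M : Subgroup W}
    (hab : d.IsAbelianPair U V) (hM : d.IsField M) (hVM : V ≤ M) (hMU : M ≤ U)
    {τ ρ : W} (hτ : τ ∈ U) (hρ : ρ ∈ M) {a c m : A}
    (hτc : d.recMap U V τ = QuotientGroup.mk c) (hρm : d.recMap M V ρ = QuotientGroup.mk m)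
    (hcam : c⁻¹ * a = norm M U m) : d.recMap U V (τ * ρ) = QuotientGroup.mk a := by
  have hU := hab.isField_left
  have hV := hab.isField_right
  have habM := hab.restrict hM hVM hMU
  have habU := hab.of_le hM hVM hMU
  have h1 : d.recMap U V ρ = QuotientGroup.mk (norm M U m) :=
    hcf.recMap_eq_mk_norm_of_recMap_eq hU hV hab.le hab.le_normalizer hM hV hVM habM.le_normalizer
      hMU le_rfl hρ hρm
  rw [hcf.recMap_mul hU hV hab.le hab.le_normalizer hτ (hMU hρ), hτc, h1, ← hcam,
    ← QuotientGroup.mk_mul, mul_inv_cancel_left]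

/-- **(6.3) — surjectivity**: for an abelian pair and the class field axiom, every class of
`A_K/N_{L|K}A_L` is an `r_{L|K}(τ)`.  Induction on `[L : K]` ("choosing a proper cyclic subextension
`M|K` of `L|K`, surjectivity follows by induction on the degree"): `r_{M|K}` is onto by the cyclic
case, `r_{L|M}` by induction, and one concludes with the norm functoriality (5.8).
[cite: NeukirchANT1999, Ch. IV §6, Thm. (6.3)] -/
theorem IsClassFieldTheory.exists_recMap_eq (hcf : d.IsClassFieldTheory) {U V : Subgroup W}
    (hab : d.IsAbelianPair U V) {a : A} (ha : a ∈ fixedBy A U) :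
    ∃ τ ∈ U, d.recMap U V τ = QuotientGroup.mk a := by
  -- strong induction on the index `(U : V)`
  suffices H : ∀ (n : ℕ) (U V : Subgroup W), d.IsAbelianPair U V → V.relIndex U = n →
      ∀ a ∈ fixedBy A U, ∃ τ ∈ U, d.recMap U V τ = QuotientGroup.mk a from
    H _ U V hab rfl a ha
  intro n
  induction n using Nat.strong_induction_on with | _ n ih => ?_
  intro U V hab hn a ha
  have hU := hab.isField_left
  have hV := hab.isField_right
  haveI := d.finiteIndex hU
  haveI := d.finiteIndex hV
  by_cases hUV : U ≤ V
  · -- `L = K`: `a = N_{U|U}(a)` is a norm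
    refine ⟨1, U.one_mem, ?_⟩
    rw [d.recMap_eq_one_of_mem hU hV hab.le hab.le_normalizer V.one_mem, eq_comm,
      QuotientGroup.eq_one_iff]
    have hVU : V = U := le_antisymm hab.le hUV
    rw [hVU, ← norm_eq_self_of_le le_rfl ha]
    exact norm_mem_normGroup ha
  · -- a proper cyclic quotient `M|K`
    obtain ⟨τ₀, hτ₀U, hτ₀V⟩ := Set.not_subset.mp hUV
    obtain ⟨M, σ, hVM, hτ₀M, hcp⟩ := hab.exists_isCyclicPair_not_mem hτ₀U hτ₀V
    have hM := hcp.isField_right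
    have hMU := hcp.le
    haveI := d.finiteIndex hM
    have habM : d.IsAbelianPair M V := hab.restrict hM hVM hMU
    -- `(M : V) < (U : V)`
    have hlt : V.relIndex M < n := by
      rw [← hn, ← Subgroup.relIndex_mul_relIndex V M U hVM hMU]
      have h1 : 0 < V.relIndex M := Nat.pos_of_ne_zero Subgroup.FiniteIndex.index_ne_zero
      have h2 : 1 < M.relIndex U := by
        have h3 : M.relIndex U ≠ 0 := Subgroup.FiniteIndex.index_ne_zero
        have h4 : M.relIndex U ≠ 1 := fun h => hτ₀M (Subgroup.relIndex_eq_one.mp h hτ₀U)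
        omega
      exact lt_mul_of_one_lt_right h1 h2
    -- `r_{M|K}` is onto (cyclic case): `r_{U,M}(τ) = a`
    obtain ⟨τ, hτ, hτa⟩ := hcf.exists_recMap_eq_of_isCyclicPair hcp ha
    -- `r_{L|K}(τ) = c`, and `c⁻¹ a ∈ N_{M|K} A_M`
    obtain ⟨c, hc, hτc⟩ := d.recMap_mem_range hU hV hab.le_normalizer hτ
    have h1 : d.recMap U M τ = QuotientGroup.mk c := by
      rw [hcf.recMap_eq_map_recMap hU hM hMU hcp.le_normalizer hV hab.le hab.le_normalizer hVM hτ,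
        hτc]
      rfl
    rw [hτa, QuotientGroup.eq] at h1
    obtain ⟨m, hm, hmca⟩ := mem_normGroup_iff.mp ((normGroup M U).inv_mem h1)
    rw [mul_inv_rev, inv_inv] at hmca
    -- `r_{L|M}` is onto (induction): `r_{M,V}(ρ) = m`
    obtain ⟨ρ, hρ, hρm⟩ := ih _ hlt M V habM rfl m hm
    exact ⟨τ * ρ, U.mul_mem hτ (hMU hρ), hcf.recMap_mul_eq_of_tower hab hM hVM hMU hτ hρ hτc hρm hmca.symm⟩

/-! ### The reciprocity isomorphism: range and kernel of `r_{L|K}` -/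

section RangeKer

variable {U V : Subgroup W}

/-- The image of `r_{L|K}`: `r_{L|K}(G_K) = A_K / N_{L|K} A_L` for an abelian pair.
[cite: NeukirchANT1999, Ch. IV §6, Thm. (6.3)] -/
theorem IsClassFieldTheory.range_recHom (hcf : d.IsClassFieldTheory) (hab : d.IsAbelianPair U V) :
    (hcf.recHom hab.isField_left hab.isField_right hab.le hab.le_normalizer).range =
      (fixedBy A U).map (QuotientGroup.mk' (normGroup V U)) := by
  apply le_antisymm (hcf.range_recHom_le _ _ _ _)
  rintro _ ⟨a, ha, rfl⟩
  obtain ⟨τ, hτ, h⟩ := hcf.exists_recMap_eq hab ha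
  exact ⟨⟨τ, hτ⟩, h⟩

/-- The kernel of `r_{L|K}`: `ker r_{L|K} = G_L` for an abelian pair (so `r_{L|K}` induces an
isomorphism `G(L|K) = U/V ≅ A_K/N_{L|K}A_L`, Neukirch (6.3)). [cite: NeukirchANT1999, Ch. IV §6, Thm. (6.3)] -/
theorem IsClassFieldTheory.ker_recHom (hcf : d.IsClassFieldTheory) (hab : d.IsAbelianPair U V) :
    (hcf.recHom hab.isField_left hab.isField_right hab.le hab.le_normalizer).ker = V.subgroupOf U := by
  ext τ
  rw [MonoidHom.mem_ker, Subgroup.mem_subgroupOf, hcf.recHom_apply]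
  exact hcf.recMap_eq_one_iff hab τ.2

/-- **The norm residue symbol as a representative**: for `a ∈ A_K` a chosen `τ ∈ G_K` with
`r_{L|K}(τ) = a mod N_{L|K} A_L` (well defined modulo `G_L` by `recMap_eq_recMap_iff`; Neukirch's
`(a, L|K) = r_{L|K}⁻¹(a mod N_{L|K}A_L)`). [cite: NeukirchANT1999, Ch. IV §6, after Thm. (6.3)] -/
def IsClassFieldTheory.normResidue (hcf : d.IsClassFieldTheory) (hab : d.IsAbelianPair U V)
    {a : A} (ha : a ∈ fixedBy A U) : W :=
  (hcf.exists_recMap_eq hab ha).choose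

/-- `(a, L|K) ∈ G_K`. [folklore] -/
theorem IsClassFieldTheory.normResidue_mem (hcf : d.IsClassFieldTheory) (hab : d.IsAbelianPair U V)
    {a : A} (ha : a ∈ fixedBy A U) : hcf.normResidue hab ha ∈ U :=
  (hcf.exists_recMap_eq hab ha).choose_spec.1

/-- `r_{L|K}((a, L|K)) = a mod N_{L|K} A_L`. [cite: NeukirchANT1999, Ch. IV §6, after Thm. (6.3)] -/
theorem IsClassFieldTheory.recMap_normResidue (hcf : d.IsClassFieldTheory) (hab : d.IsAbelianPair U V)
    {a : A} (ha : a ∈ fixedBy A U) : d.recMap U V (hcf.normResidue hab ha) = QuotientGroup.mk a :=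
  (hcf.exists_recMap_eq hab ha).choose_spec.2

/-- `(a, L|K) ≡ τ (mod G_L) ↔ r_{L|K}(τ) = a mod N_{L|K}A_L`, for `τ ∈ G_K`. [folklore] -/
theorem IsClassFieldTheory.normResidue_inv_mul_mem_iff (hcf : d.IsClassFieldTheory)
    (hab : d.IsAbelianPair U V) {a : A} (ha : a ∈ fixedBy A U) {τ : W} (hτ : τ ∈ U) :
    (hcf.normResidue hab ha)⁻¹ * τ ∈ V ↔ d.recMap U V τ = QuotientGroup.mk a := by
  rw [← hcf.recMap_eq_recMap_iff hab (hcf.normResidue_mem hab ha) hτ, hcf.recMap_normResidue hab ha,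
    eq_comm]

/-- Multiplicativity of the norm residue symbol modulo `G_L`. [cite: NeukirchANT1999, Ch. IV §6, after Thm. (6.3)] -/
theorem IsClassFieldTheory.normResidue_mul_inv_mul_mem (hcf : d.IsClassFieldTheory)
    (hab : d.IsAbelianPair U V) {a b : A} (ha : a ∈ fixedBy A U) (hb : b ∈ fixedBy A U) :
    (hcf.normResidue hab ((fixedBy A U).mul_mem ha hb))⁻¹ *
      (hcf.normResidue hab ha * hcf.normResidue hab hb) ∈ V := by
  rw [hcf.normResidue_inv_mul_mem_iff hab _ (U.mul_mem (hcf.normResidue_mem hab ha) (hcf.normResidue_mem hab hb)),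
    hcf.recMap_mul hab.isField_left hab.isField_right hab.le hab.le_normalizer
      (hcf.normResidue_mem hab ha) (hcf.normResidue_mem hab hb),
    hcf.recMap_normResidue, hcf.recMap_normResidue, QuotientGroup.mk_mul]

/-- The norm residue symbol of `1` lies in `G_L`. [folklore] -/
theorem IsClassFieldTheory.normResidue_one_mem (hcf : d.IsClassFieldTheory) (hab : d.IsAbelianPair U V) :
    hcf.normResidue hab (fixedBy A U).one_mem ∈ V := by
  have h := hcf.normResidue_inv_mul_mem_iff hab (fixedBy A U).one_mem (U.one_mem)
  rw [mul_one, inv_mem_iff, d.recMap_eq_one_of_mem hab.isField_left hab.isField_right hab.le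
    hab.le_normalizer V.one_mem] at h
  exact h.mpr rfl

/-- **Kernel of the norm residue symbol**: `(a, L|K) ∈ G_L ↔ a ∈ N_{L|K} A_L`.
[cite: NeukirchANT1999, Ch. IV §6, after Thm. (6.3)] -/
theorem IsClassFieldTheory.normResidue_mem_iff (hcf : d.IsClassFieldTheory) (hab : d.IsAbelianPair U V)
    {a : A} (ha : a ∈ fixedBy A U) : hcf.normResidue hab ha ∈ V ↔ a ∈ normGroup V U := by
  rw [← hcf.recMap_eq_one_iff hab (hcf.normResidue_mem hab ha), hcf.recMap_normResidue, QuotientGroup.eq_one_iff]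

/-- **Surjectivity of the norm residue symbol**: every `τ ∈ G_K` is `≡ (a, L|K)` modulo `G_L` for some
`a ∈ A_K`. [cite: NeukirchANT1999, Ch. IV §6, after Thm. (6.3)] -/
theorem IsClassFieldTheory.exists_normResidue_inv_mul_mem (hcf : d.IsClassFieldTheory)
    (hab : d.IsAbelianPair U V) {τ : W} (hτ : τ ∈ U) :
    ∃ (a : A) (ha : a ∈ fixedBy A U), (hcf.normResidue hab ha)⁻¹ * τ ∈ V := by
  obtain ⟨a, ha, h⟩ := d.recMap_mem_range hab.isField_left hab.isField_right hab.le_normalizer hτ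
  exact ⟨a, ha, (hcf.normResidue_inv_mul_mem_iff hab ha hτ).mpr h⟩

end RangeKer

/-! ### The inertia clause: units and the inertia group -/

/-- **Units are norm residues of inertia elements**: for `L|K` abelian and `u ∈ U_K` there is
`i ∈ G(L̃|K̃) = G_K ∩ I` with `r_{L|K}(i) = u mod N_{L|K} A_L`.  (With `M = L ∩ K̃`: `u = N_{M|K}(ε)`,
`ε ∈ U_M` by (6.2); `ε ≡ r_{L|M}(ρ)` by (6.3) for `L|M`; then `r_{L|K}(ρ) ≡ N_{M|K}(ε) = u` by (5.8),
and `ρ ∈ G_M = G_L · (G_K ∩ I)` may be replaced by its inertia component.)  In the local case this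
is `θ(U_K) ⊇` the inertia subgroup (Serre XIII §4, Cor. to Prop. 13).
[cite: NeukirchANT1999, Ch. IV §6, (6.2)–(6.3) with §5 (5.8)] -/
theorem IsClassFieldTheory.exists_inertia_recMap_eq_of_unit (hcf : d.IsClassFieldTheory)
    {U V : Subgroup W} (hab : d.IsAbelianPair U V) {u : A} (hu : u ∈ d.unitGroup U) :
    ∃ i ∈ U ⊓ d.inertia, d.recMap U V i = QuotientGroup.mk u := by
  have hU := hab.isField_left
  have hV := hab.isField_right
  haveI := d.finiteIndex hU
  haveI := d.finiteIndex hV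
  set M := V ⊔ (U ⊓ d.inertia) with hM_def
  have hVM : V ≤ M := le_sup_left
  have hMU : M ≤ U := sup_le hab.le inf_le_left
  have hM : d.IsField M := d.isField_of_le hV hVM
  haveI := d.finiteIndex hM
  have hunr : d.IsUnramified M U := le_sup_right
  have habM : d.IsAbelianPair M V := hab.restrict hM hVM hMU
  -- (6.2): `u = N_{M|K}(ε)`, `ε ∈ U_M`
  obtain ⟨ε, hε, hNε⟩ := hcf.exists_unit_norm_eq hU hM hMU hunr hu
  have hεM := d.unitGroup_le_fixedBy hM hε
  -- (6.3) for `L|M`: `ε ≡ r_{L|M}(ρ)`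
  obtain ⟨ρ, hρ, hρε⟩ := hcf.exists_recMap_eq habM hεM
  -- (5.8): `r_{L|K}(ρ) ≡ N_{M|K}(ε) = u`
  have h1 : d.recMap U V ρ = QuotientGroup.mk u := by
    rw [← hNε]
    exact hcf.recMap_eq_mk_norm_of_recMap_eq hU hV hab.le hab.le_normalizer hM hV hVM
      habM.le_normalizer hMU le_rfl hρ hρε
  -- `ρ = v i`
  obtain ⟨v, hv, i, hi, rfl⟩ := d.exists_eq_mul_of_mem_sup_inf_inertia hab.le hρ
  have hiU : i ∈ U := (Subgroup.mem_inf.mp hi).1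
  refine ⟨i, hi, ?_⟩
  have h2 : d.recMap U V (v * i) = d.recMap U V i := by
    apply hcf.recMap_congr hU hV hab.le hab.le_normalizer (hMU hρ) hiU
    have : (v * i)⁻¹ * i = i⁻¹ * v⁻¹ * i⁻¹⁻¹ := by group
    rw [this]
    exact (Subgroup.mem_normalizer_iff.mp (hab.le_normalizer (U.inv_mem hiU)) v⁻¹).mp (V.inv_mem hv)
  rw [← h2, h1]

/-- **Inertia elements are sent to units**: for `L|K` abelian and `i ∈ G_K ∩ I` one has
`r_{L|K}(i) = u mod N_{L|K} A_L` for some `u ∈ U_K`.  (With `M = L ∩ K̃`, `L|M` is totally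
ramified: `r_{L|K}(i) = N_{M|K}(r̃_{L|M}(i'))` by (5.8), `v_M(r̃_{L|M}(i')) = d_M(i') = m`, and
`N_{L|M}(π_L)^m ∈ N_{L|M} A_L` has the same valuation, so `r̃ ≡ ε ∈ U_M` and `N_{M|K}(ε) ∈ U_K`.)
[cite: NeukirchANT1999, Ch. IV §5, (5.2), (5.8); §4 (4.7)] -/
theorem IsClassFieldTheory.exists_unit_recMap_eq_of_mem_inertia (hcf : d.IsClassFieldTheory)
    {U V : Subgroup W} (hab : d.IsAbelianPair U V) {i : W} (hi : i ∈ U ⊓ d.inertia) :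
    ∃ u ∈ d.unitGroup U, d.recMap U V i = QuotientGroup.mk u := by
  have hU := hab.isField_left
  have hV := hab.isField_right
  haveI := d.finiteIndex hU
  haveI := d.finiteIndex hV
  set M := V ⊔ (U ⊓ d.inertia) with hM_def
  have hVM : V ≤ M := le_sup_left
  have hMU : M ≤ U := sup_le hab.le inf_le_left
  have hM : d.IsField M := d.isField_of_le hV hVM
  haveI := d.finiteIndex hM
  have habM : d.IsAbelianPair M V := hab.restrict hM hVM hMU
  have hfVM : d.f V = d.f M := (d.f_sup_inf_inertia hV hab.le).symm
  have hiM : i ∈ M := Subgroup.mem_sup_right hi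
  -- `r_{L|K}(i) = N_{M|K}(r̃_{L|M}(i'))`
  set i' := d.frobLift M V i with hi'_def
  have hi'M : i' ∈ M := d.frobLift_mem hM hiM
  have hd : 0 < d.degZ i' := d.degZ_frobLift_pos hM hV i
  have hlift : i⁻¹ * i' ∈ V := d.inv_mul_frobLift_mem hM hV hVM habM.le_normalizer i
  have h1 := hcf.recMap_eq_mk_norm_recElt hU hV hab.le hab.le_normalizer hM hV hVM habM.le_normalizer
    hMU le_rfl hiM hi'M hd hlift
  -- the valuation of `r̃ = N_{Σ|M}(π_Σ)` is `f_Σ / f_M = m`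
  set S := d.frobField V i' with hS_def
  have hS : d.IsField S := d.isField_frobField hV (habM.le_normalizer hi'M) hd
  haveI := d.finiteIndex hS
  have hSM : S ≤ M := d.frobField_le hVM hi'M
  obtain ⟨m, hm⟩ := d.f_dvd_f hM hS hSM
  have hrM : d.recElt M V i' ∈ fixedBy A M := d.recElt_mem_fixedBy hV habM.le_normalizer hi'M hd
  have hvr : d.val M (d.recElt M V i') = m := by
    change d.val M (norm S M (d.primeOf S)) = m
    rw [d.val_norm hM hS hSM (d.primeOf_mem hS), d.val_primeOf hS, mul_one, hm]
    push_cast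
    rw [Int.mul_ediv_cancel_left _ (d.f_ne_zero hM)]
  -- `N_{L|M}(π_L)` has valuation `1` (`L|M` totally ramified)
  obtain ⟨πL, hπL, hvπL⟩ := d.exists_val_eq_one hV
  have hNπM : norm V M πL ∈ fixedBy A M := norm_mem_fixedBy hπL
  have hvN : d.val M (norm V M πL) = 1 := by
    rw [d.val_norm hM hV hVM hπL, hfVM, Int.ediv_self (d.f_ne_zero hM), hvπL, mul_one]
  -- the unit `ε = r̃ / N_{L|M}(π_L)^m`
  set ε := d.recElt M V i' / norm V M πL ^ m with hε_def
  have hε : ε ∈ d.unitGroup M := by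
    refine (d.mem_unitGroup_iff hM).mpr ⟨(fixedBy A M).div_mem hrM ((fixedBy A M).pow_mem hNπM m), ?_⟩
    rw [hε_def, d.val_div hM hrM ((fixedBy A M).pow_mem hNπM m), d.val_pow hM hNπM, hvr, hvN, mul_one,
      sub_self]
  refine ⟨norm M U ε, d.norm_mem_unitGroup hU hM hMU hε, ?_⟩
  rw [h1, QuotientGroup.eq]
  have : (norm M U (d.recElt M V i'))⁻¹ * norm M U ε = (norm V U (πL ^ m))⁻¹ := by
    rw [hε_def, norm_div, ← norm_pow, norm_norm hVM hMU ((fixedBy A V).pow_mem hπL m), div_eq_mul_inv,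
      inv_mul_cancel_left]
  rw [this]
  exact (normGroup V U).inv_mem (norm_mem_normGroup ((fixedBy A V).pow_mem hπL m))

end WeilDatum

end AbstractCFT

end Literature.NumberTheory.GaloisRepresentations
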